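import Summits.QuantumFields.BalabanUV.Beta.GAN24.CombHalfMemberCellOfDivergences
import Summits.QuantumFields.BalabanUV.Beta.GAN24.HalfMemberCellDriftOfDivergences

/-!
# `BalabanUV.Beta.GAN24.CombHalfMemberCellDriftOfDivergences` — binder row G-an2-4 ∕ (CONV-C), W-slot, TRANSFER-III: **(C-6d) THE ONE-STEP DRIFT OF THE COMB-CHART CELLS FROM THE
# FOUR LETTER ROWS AND THE FOUR LETTER-DRIFT ROWS** — the (III′) twin of MY g66 `HalfMemberCellDriftOfDivergences.cellDrift_rows_of_divergence_rows` (the OWNER gan24-p1's `hcelld`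
# row of `CombT2DriftEvenEnd`), composed BY NAME from (C-6) `CombHalfMemberCellOfDivergences.comb_cell_eq_lin4_combDefect` (the comb cell IS `𝒜^K_l` of the comb defect table
# `W_l := 𝔇 (𝒯₄ Z_l − Z_l) + (𝔇 Z_l − Z_l)`), the LINEARITY of `𝒯₄` (§1, from d1-formalise-leaf-03's four `SymCorrectorSlot` apply lemmas) and of `𝔇` (MY g66
# `TableDressingExpansion.tableDress_sub`), (C-4) `PsiTableDefectOfDivergences.locStencil₂_psiTable_sub_self_of_divergence_rows` on the DIFFERENCES (§2 `psiTableConst_mul`: its constant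
# is linear in the four letters), MY g66 FILE 1 ∕ §1 (`locStencil₂_tableDress_sub_self_of_divergences`, `locStencil₂_tableDress_defect_sub_of_divergences`, `defectConst_mul`), and the
# g66 FILE 2 skeleton VERBATIM: leaf-01's `lin4_sub`, MY `TransportStepLipschitz.lin_cauchy` on `W_{l+1}`, leaf-01's `exists_lin4_rate` on `W_{l+1} − W_l`, `locStencil₂_add_rate`.

NOT IN PRINT; OUR BOOKKEEPING (G-an2-4 crux team (2), leaf prover `b2b-balaban-gan24-formalise-leaf-03`, gen 79).  [folklore] composition BY NAME; 0 `def`, 0 cited facts, 0 `def … : Prop`, 0 sorry.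
DISPLAYED — EXACTLY the rows of MY g66 `cellDrift_rows_of_divergence_rows`, `hLc : 2 ≤ Lc` for `hr`: road P1's undressed unit step kernels' UNIFORM decay `hK` AND CAUCHY row `hKc`
(`θK`), the tables' shapes `hZ` (SOME, per `l`), the four letter rows `h₂ h₁ hL₁ hL₂` (`l`-free constants) and the four letter-DRIFT rows `h₂' h₁' hL₁' hL₂'` (constants `C′·θ^l`),
one rate `δ`.  The rows are HYPOTHESES (at (III′) they wait on an2's comb Ward laws through road-P2's L3 and on the comb LEG dictionary — the OWNER's W-4 (3)).
HONEST DEPENDENCY (verbatim): «continuum YM on T⁴ ⇐ BetaPertH ∧ nine spine estimates (0/9 proved); BetaPertH ⇐ (D1) ∧ (D4) ∧ CAP+tail; G-an2-4 gates asym, D1 and NE2/3/4.»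
WHAT THIS IS NOT: NOT the letter rows at the comb data, NOT a value; zero weight; NEVER «G-an2-4 closed» as (CONV-C); NOT D1, NOT `BetaPertH`, NOT continuum, NOT Clay.  2026-08-25.
-/

noncomputable section

open Finset
open scoped BigOperators
open Literature.MathematicalPhysics.QuantumFieldTheory
open Literature.MathematicalPhysics.QuantumFieldTheory.Balaban1983to89
open Literature.MathematicalPhysics.QuantumFieldTheory.Balaban1983to89.Beta
open ExpKernelCalculus (MKer Site BiLoc Decays comp)
open OneStepResolventKernel (Fib LocStencil decays_mono)
open OneStepKernelFamily (KInvStep)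
open KernelWard (divV)
open AffineAveraging (box unitVec toSite)
open AveragingContoursRooted (ctr ctrOff ctrOff_mem_box)
open BalabanCompositeJets (LocStencil₂)
open BalabanStepW2 (locStencil₂_add')
open SecondOrderResponse (cBi)
open Summit.QuantumFields.BalabanUV.Beta.TameKernelCalculus
open Summit.QuantumFields.BalabanUV.Beta.HessKerDressedUnits (unitK)
open Summit.QuantumFields.BalabanUV.Beta.AxialDressingRooted (cWb cKb coDressKBmAt dressKBmAt coProjBmAtK one_le_of_neZero)
open Summit.QuantumFields.BalabanUV.Beta.SymCorrectorKernel (psiKS)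
open Summit.QuantumFields.BalabanUV.Beta.SymCorrectorFace (slotPsiS faceSum faceWtSum)
open Summit.QuantumFields.BalabanUV.Beta.SymCorrectorSlot (comp_trK_psiKS_inl_left comp_trK_psiKS_inr_left comp_psiKS_inl_right comp_psiKS_inr_right)
open Summit.QuantumFields.BalabanUV.Beta.CombChartStepJets (GcombSh)
open Summit.QuantumFields.BalabanUV.Beta.GAN24.CombesThomas (sfStep smStep)
open Summit.QuantumFields.BalabanUV.Beta.GAN24.T2RecursionAffine (lin4)
open Summit.QuantumFields.BalabanUV.Beta.GAN24.BiStencilZeroMode (Tab)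
open Summit.QuantumFields.BalabanUV.Beta.GAN24.Lin4Additive (lin4_sub)
open Summit.QuantumFields.BalabanUV.Beta.GAN24.TableDressingDefect (locStencil₂_tableDress)
open Summit.QuantumFields.BalabanUV.Beta.GAN24.TableDressingExpansion (tableDress_sub)
open Summit.QuantumFields.BalabanUV.Beta.GAN24.WSlotT2OfPieces (sup_of_locStencil₂)
open Summit.QuantumFields.BalabanUV.Beta.GAN24.WSlotCauchyOfShapes (locStencil₂_le_mono)
open Summit.QuantumFields.BalabanUV.Beta.GAN24.SecondOrderLipschitz (lSand)
open Summit.QuantumFields.BalabanUV.Beta.GAN24.SecondOrderLipschitzBi (lBi)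
open Summit.QuantumFields.BalabanUV.Beta.GAN24.TransportStepLipschitz (lin_cauchy)
open Summit.QuantumFields.BalabanUV.Beta.GAN24.T2DevConservationDefectRows (exists_lin4_rate locStencil₂_add_rate)
open Summit.QuantumFields.BalabanUV.Beta.GAN24.DressingDefectOfDivergences (locStencil₂_tableDress_sub_self_of_divergences)
open Summit.QuantumFields.BalabanUV.Beta.GAN24.HalfMemberCellDriftOfDivergences (locStencil₂_tableDress_defect_sub_of_divergences defectConst_mul)
open Summit.QuantumFields.BalabanUV.Beta.GAN24.PsiTableDefectOfDivergences (locStencil₂_psiTable_sub_self_of_divergence_rows)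
open Summit.QuantumFields.BalabanUV.Beta.GAN24.CombHalfMemberCellOfDivergences (comb_cell_eq_lin4_combDefect)

namespace Summit.QuantumFields.BalabanUV.Beta.GAN24.CombHalfMemberCellDriftOfDivergences

variable {d : ℕ}

/-! ## §1 `𝒯₄` is linear: the four-variable Ψ-defect of a difference -/

section Linear

variable {n : ℕ} (hn : 0 < n) {r : Fin (d + 1) → ℕ} (hr : r ∈ box (d + 1) n)

/-- [folklore] The slot transport is additive over differences of (vector-valued) slot tables.  `private`: the public tree twin is leaf-01 g79's
`GAN24.SlotTransportParity.slotPsiS_sub` (landed 12:17Z 2026-08-25, after this file was staged; leaf-04 g76 N-C6D1) — a consumer imports THAT one. -/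
private theorem slotPsiS_sub {E : Type*} [AddCommGroup E] [Module ℝ E] (T T' : Fin (d + 1) → Site (d + 1) → E) :
    slotPsiS r n (T - T') = slotPsiS r n T - slotPsiS r n T' := by
  funext α x
  simp only [slotPsiS, faceSum, Pi.sub_apply, smul_sub, Finset.sum_sub_distrib]
  abel

/-- [folklore] The slot transport is additive over differences, pointwise-lambda form. -/
theorem slotPsiS_sub_apply {E : Type*} [AddCommGroup E] [Module ℝ E] (T T' : Fin (d + 1) → Site (d + 1) → E) (α : Fin (d + 1)) (x : Site (d + 1)) :
    slotPsiS r n (fun κ u => T κ u - T' κ u) α x = slotPsiS r n T α x - slotPsiS r n T' α x := by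
  simp only [slotPsiS, faceSum, smul_sub, Finset.sum_sub_distrib]
  abel

include hn hr in
/-- [folklore] The left Ψ-leg `Ψ̂ᵀ ∘ ·` is additive over differences of kernels (d1-formalise-leaf-03's two left apply lemmas; no summability needed). -/
theorem comp_trK_psiKS_sub (X X' : MKer (d + 1) (Fib d)) :
    comp (trK (psiKS r n)) (X - X') = comp (trK (psiKS r n)) X - comp (trK (psiKS r n)) X' := by
  funext x w a b
  rcases a with α | m
  · simp only [Pi.sub_apply, comp_trK_psiKS_inl_left hn hr]
    exact slotPsiS_sub_apply _ _ α x
  · simp only [Pi.sub_apply, comp_trK_psiKS_inr_left]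

include hn hr in
/-- [folklore] The right Ψ-leg `· ∘ Ψ̂` is additive over differences of kernels (d1-formalise-leaf-03's two right apply lemmas). -/
theorem comp_psiKS_sub (X X' : MKer (d + 1) (Fib d)) :
    comp (X - X') (psiKS r n) = comp X (psiKS r n) - comp X' (psiKS r n) := by
  funext x w a b
  rcases b with β | m
  · simp only [Pi.sub_apply, comp_psiKS_inl_right hn hr]
    exact slotPsiS_sub_apply _ _ β w
  · simp only [Pi.sub_apply, comp_psiKS_inr_right]

include hn hr in
/-- NOT IN PRINT; OUR BOOKKEEPING.  **THE FOUR-VARIABLE Ψ-DEFECT IS ADDITIVE OVER DIFFERENCES OF BI-TABLES**: `(𝒯₄ (Y − Y′) − (Y − Y′)) = (𝒯₄ Y − Y) − (𝒯₄ Y′ − Y′)`. -/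
theorem psiDefect_sub (Y Y' : Tab d) :
    (fun κ u κ' u' => comp (trK (psiKS r n)) (comp (slotPsiS r n (slotPsiS r n (Y - Y') κ u) κ' u') (psiKS r n)) - (Y - Y') κ u κ' u')
      = (fun κ u κ' u' => comp (trK (psiKS r n)) (comp (slotPsiS r n (slotPsiS r n Y κ u) κ' u') (psiKS r n)) - Y κ u κ' u')
        - (fun κ u κ' u' => comp (trK (psiKS r n)) (comp (slotPsiS r n (slotPsiS r n Y' κ u) κ' u') (psiKS r n)) - Y' κ u κ' u') := by
  funext κ u κ' u'
  simp only [Pi.sub_apply]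
  rw [slotPsiS_sub Y Y']
  simp only [Pi.sub_apply]
  rw [slotPsiS_sub (slotPsiS r n Y κ u) (slotPsiS r n Y' κ u)]
  simp only [Pi.sub_apply]
  rw [comp_psiKS_sub hn hr, comp_trK_psiKS_sub hn hr]
  abel

end Linear

/-! ## §2 The (C-4) constant is linear in the four letters -/

/-- Bookkeeping of the constant of `PsiTableDefectOfDivergences.locStencil₂_psiTable_sub_self_of_divergence_rows` (`K(C₁, C₂, C_{L1}, C_{L2})`, linear in the letters):
`K(C₁ t, C₂ t, C_{L1} t, C_{L2} t) = K(C₁, C₂, C_{L1}, C_{L2}) · t`. -/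
theorem psiTableConst_mul (d n : ℕ) (r : Fin (d + 1) → ℕ) (δ C₁ C₂ CL₁ CL₂ t : ℝ) :
    ((faceWtSum r n * (((n : ℝ) ^ (d + 1)) * (Real.exp (δ * (((d : ℝ) + 1) * n))
            * (((CL₁ * t) * (1 + faceWtSum r n * (((d + 1 : ℕ) : ℝ) * (2 * (n : ℝ) ^ (d + 1))) * Real.exp (δ * (3 * (((d + 1 : ℕ) : ℝ) * n))))
                  * (1 + faceWtSum r n * (((d + 1 : ℕ) : ℝ) * (2 * (n : ℝ) ^ (d + 1))) * Real.exp (δ * (((d + 1 : ℕ) : ℝ) * n))))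
              * (1 + faceWtSum r n * (((d : ℝ) + 1) * ((2 * (n : ℝ) ^ (d + 1)) * Real.exp (δ * (((d : ℝ) + 1) * n))))))))
        + faceWtSum r n * (((n : ℝ) ^ (d + 1)) * (Real.exp (δ * (((d : ℝ) + 1) * n))
            * ((CL₂ * t) * (1 + faceWtSum r n * (((d + 1 : ℕ) : ℝ) * (2 * (n : ℝ) ^ (d + 1))) * Real.exp (δ * (3 * (((d + 1 : ℕ) : ℝ) * n))))
                  * (1 + faceWtSum r n * (((d + 1 : ℕ) : ℝ) * (2 * (n : ℝ) ^ (d + 1))) * Real.exp (δ * (((d + 1 : ℕ) : ℝ) * n)))))))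
      + (faceWtSum r n * (((n : ℝ) ^ (d + 1)) * (Real.exp (3 * δ * (((d : ℝ) + 1) * n))
            * (C₁ * t + faceWtSum r n * (((d : ℝ) + 1) * ((2 * (n : ℝ) ^ (d + 1)) * (Real.exp (δ * (((d : ℝ) + 1) * n)) * (C₁ * t)))))))
          + faceWtSum r n * (((n : ℝ) ^ (d + 1)) * (Real.exp (δ * (((d : ℝ) + 1) * n)) * (C₂ * t)))))
      = ((faceWtSum r n * (((n : ℝ) ^ (d + 1)) * (Real.exp (δ * (((d : ℝ) + 1) * n))
            * ((CL₁ * (1 + faceWtSum r n * (((d + 1 : ℕ) : ℝ) * (2 * (n : ℝ) ^ (d + 1))) * Real.exp (δ * (3 * (((d + 1 : ℕ) : ℝ) * n))))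
                  * (1 + faceWtSum r n * (((d + 1 : ℕ) : ℝ) * (2 * (n : ℝ) ^ (d + 1))) * Real.exp (δ * (((d + 1 : ℕ) : ℝ) * n))))
              * (1 + faceWtSum r n * (((d : ℝ) + 1) * ((2 * (n : ℝ) ^ (d + 1)) * Real.exp (δ * (((d : ℝ) + 1) * n))))))))
        + faceWtSum r n * (((n : ℝ) ^ (d + 1)) * (Real.exp (δ * (((d : ℝ) + 1) * n))
            * (CL₂ * (1 + faceWtSum r n * (((d + 1 : ℕ) : ℝ) * (2 * (n : ℝ) ^ (d + 1))) * Real.exp (δ * (3 * (((d + 1 : ℕ) : ℝ) * n))))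
                  * (1 + faceWtSum r n * (((d + 1 : ℕ) : ℝ) * (2 * (n : ℝ) ^ (d + 1))) * Real.exp (δ * (((d + 1 : ℕ) : ℝ) * n)))))))
      + (faceWtSum r n * (((n : ℝ) ^ (d + 1)) * (Real.exp (3 * δ * (((d : ℝ) + 1) * n))
            * (C₁ + faceWtSum r n * (((d : ℝ) + 1) * ((2 * (n : ℝ) ^ (d + 1)) * (Real.exp (δ * (((d : ℝ) + 1) * n)) * C₁))))))
          + faceWtSum r n * (((n : ℝ) ^ (d + 1)) * (Real.exp (δ * (((d : ℝ) + 1) * n)) * C₂)))) * t := by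
  ring

/-! ## §3 (C-6d): the one-step drift of the comb cells from the eight rows -/

section Generic

variable {Lc : ℕ} [NeZero Lc]

/-- NOT IN PRINT; OUR BOOKKEEPING.  **THE COMB CELLS' ONE-STEP DRIFT FROM THE FOUR LETTER ROWS AND THE FOUR LETTER-DRIFT ROWS** (generic `d`, `2 ≤ Lc`, any `c`, ANY family
`Z : ℕ → Tab d` with SOME `LocStencil₂` shape each): under road P1's undressed unit step kernels' UNIFORM decay `hK` and CAUCHY row `hKc` (DISPLAYED), the four letter rows on `Z_l`
(`l`-free `C₂ C₁ C_{L1} C_{L2}`) and the four letter rows on the DIFFERENCES `Z_{l+1} − Z_l` (constants `C′_s·θ^l`, `0 ≤ θ < 1`), all at one rate `δ > 0`, give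
`∃ Ccd θc δcd, 0 ≤ Ccd ∧ 0 ≤ θc ∧ θc < 1 ∧ 0 < δcd ∧ ∀ l, LocStencil₂ (cell_{l+1} − cell_l) (Ccd·θc^l) δcd`, `cell_l := 𝒜^{G′}_l Z_l − 𝒜^{K}_l Z_l`, `G′_l = unitK_l (GcombSh Lc l)`
(`θc = max θK θ`) — the binders of MY g66 `cellDrift_rows_of_divergence_rows` VERBATIM with `hLc` for `hr`.  Route: `cell_l = 𝒜^K_l W_l` ((C-6) `comb_cell_eq_lin4_combDefect`,
`W_l = 𝔇 (𝒯₄ Z_l − Z_l) + (𝔇 Z_l − Z_l)`), `cell_{l+1} − cell_l = (𝒜^K_{l+1} − 𝒜^K_l) W_{l+1} + 𝒜^K_l (W_{l+1} − W_l)` (leaf-01's `lin4_sub`), MY `lin_cauchy` on `W_{l+1}` ((C-4) ⨾ leaf-06's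
`locStencil₂_tableDress` + g66 FILE 1, `l`-free), leaf-01's `exists_lin4_rate` on `W_{l+1} − W_l = 𝔇 (Ψ-defect of (Z_{l+1} − Z_l)) + ((E)-defect difference)` (§1 `psiDefect_sub` ⨾
`tableDress_sub` ⨾ (C-4) on the difference rows ⨾ §2 ⨾ g66 §1), `locStencil₂_add_rate`. -/
theorem comb_cellDrift_rows_of_divergence_rows (hLc : 2 ≤ Lc) (c : ℝ) (Z : ℕ → Tab d) {CK δK cK θK : ℝ}
    (hK : ∀ j : ℕ, Decays (unitK (sfStep Lc j) (smStep d Lc j) (KInvStep (d := d) Lc j)) CK δK) (hδK : 0 < δK)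
    (hKc : ∀ k j : ℕ, Decays (unitK (sfStep Lc (k + j)) (smStep d Lc (k + j)) (KInvStep (d := d) Lc (k + j))
      - unitK (sfStep Lc k) (smStep d Lc k) (KInvStep (d := d) Lc k)) (cK * θK ^ k) δK) (hθK0 : 0 ≤ θK) (hθK1 : θK < 1)
    {C₂ C₁ CL₁ CL₂ C₂' C₁' CL₁' CL₂' θ δ : ℝ} (hδ : 0 < δ) (hθ0 : 0 ≤ θ) (hθ1 : θ < 1)
    (hZ : ∀ l, ∃ CZ δZ : ℝ, 0 < δZ ∧ LocStencil₂ (Z l) CZ δZ)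
    (h₂ : ∀ l, LocStencil₂ (fun (κ : Fin (d + 1)) (u : Fin (d + 1) → ℤ) (_ : Fin (d + 1)) (p : Fin (d + 1) → ℤ) =>
      divV (fun κ₁ u₁ => Z l κ u κ₁ u₁) p) C₂ δ)
    (h₁ : ∀ l, LocStencil₂ (fun (_ : Fin (d + 1)) (p : Fin (d + 1) → ℤ) (κ' : Fin (d + 1)) (u' : Fin (d + 1) → ℤ) =>
      divV (fun κ₁ u₁ => Z l κ₁ u₁ κ' u') p) C₁ δ)
    (hL₁ : ∀ l, LocStencil₂ (fun κ u κ' u' => fun (p z : Fin (d + 1) → ℤ) (_ : Fib d) (b : Fib d) =>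
      ∑ β : Fin (d + 1), (Z l κ u κ' u' p z (Sum.inl β) b - Z l κ u κ' u' (p - unitVec β) z (Sum.inl β) b)) CL₁ δ)
    (hL₂ : ∀ l, LocStencil₂ (fun κ u κ' u' => fun (x p : Fin (d + 1) → ℤ) (a : Fib d) (_ : Fib d) =>
      ∑ β : Fin (d + 1), (Z l κ u κ' u' x p a (Sum.inl β) - Z l κ u κ' u' x (p - unitVec β) a (Sum.inl β))) CL₂ δ)
    (h₂' : ∀ l, LocStencil₂ (fun (κ : Fin (d + 1)) (u : Fin (d + 1) → ℤ) (_ : Fin (d + 1)) (p : Fin (d + 1) → ℤ) =>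
      divV (fun κ₁ u₁ => (Z (l + 1) - Z l) κ u κ₁ u₁) p) (C₂' * θ ^ l) δ)
    (h₁' : ∀ l, LocStencil₂ (fun (_ : Fin (d + 1)) (p : Fin (d + 1) → ℤ) (κ' : Fin (d + 1)) (u' : Fin (d + 1) → ℤ) =>
      divV (fun κ₁ u₁ => (Z (l + 1) - Z l) κ₁ u₁ κ' u') p) (C₁' * θ ^ l) δ)
    (hL₁' : ∀ l, LocStencil₂ (fun κ u κ' u' => fun (p z : Fin (d + 1) → ℤ) (_ : Fib d) (b : Fib d) =>
      ∑ β : Fin (d + 1), ((Z (l + 1) - Z l) κ u κ' u' p z (Sum.inl β) b - (Z (l + 1) - Z l) κ u κ' u' (p - unitVec β) z (Sum.inl β) b)) (CL₁' * θ ^ l) δ)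
    (hL₂' : ∀ l, LocStencil₂ (fun κ u κ' u' => fun (x p : Fin (d + 1) → ℤ) (a : Fib d) (_ : Fib d) =>
      ∑ β : Fin (d + 1), ((Z (l + 1) - Z l) κ u κ' u' x p a (Sum.inl β) - (Z (l + 1) - Z l) κ u κ' u' x (p - unitVec β) a (Sum.inl β))) (CL₂' * θ ^ l) δ) :
    ∃ Ccd θc δcd : ℝ, 0 ≤ Ccd ∧ 0 ≤ θc ∧ θc < 1 ∧ 0 < δcd ∧ ∀ l, LocStencil₂
      ((lin4 c (unitK (sfStep Lc (l + 1)) (smStep d Lc (l + 1)) (GcombSh (d := d) Lc (l + 1))) Lc (Z (l + 1))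
          - lin4 c (unitK (sfStep Lc (l + 1)) (smStep d Lc (l + 1)) (KInvStep (d := d) Lc (l + 1))) Lc (Z (l + 1)))
        - (lin4 c (unitK (sfStep Lc l) (smStep d Lc l) (GcombSh (d := d) Lc l)) Lc (Z l)
          - lin4 c (unitK (sfStep Lc l) (smStep d Lc l) (KInvStep (d := d) Lc l)) Lc (Z l)))
      (Ccd * θc ^ l) δcd := by
  have hLc1 : 1 ≤ Lc := le_trans (by norm_num) hLc
  have hLc0 : 0 < Lc := hLc1
  have hr : ctrOff (d + 1) Lc ∈ box (d + 1) Lc := ctrOff_mem_box hLc1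
  have hCK : 0 ≤ CK := (hK 0).nonneg (Sum.inl 0)
  -- explicit `l`-free constants: the dressing factor `κ_𝔇`, the primed (C-4) constant `K′`, MY g66's primed (E)-defect constant `C′_D`
  set κD : ℝ := cKb d Lc δ * cKb d Lc δ * (cWb d Lc * Real.exp (3 * δ * (((d : ℝ) + 1) * Lc)) * cKb d Lc δ) with hκD
  set KP : ℝ := ((faceWtSum (ctrOff (d + 1) Lc) Lc * (((Lc : ℝ) ^ (d + 1)) * (Real.exp (δ * (((d : ℝ) + 1) * Lc))
            * ((CL₁' * (1 + faceWtSum (ctrOff (d + 1) Lc) Lc * (((d + 1 : ℕ) : ℝ) * (2 * (Lc : ℝ) ^ (d + 1))) * Real.exp (δ * (3 * (((d + 1 : ℕ) : ℝ) * Lc))))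
                  * (1 + faceWtSum (ctrOff (d + 1) Lc) Lc * (((d + 1 : ℕ) : ℝ) * (2 * (Lc : ℝ) ^ (d + 1))) * Real.exp (δ * (((d + 1 : ℕ) : ℝ) * Lc))))
              * (1 + faceWtSum (ctrOff (d + 1) Lc) Lc * (((d : ℝ) + 1) * ((2 * (Lc : ℝ) ^ (d + 1)) * Real.exp (δ * (((d : ℝ) + 1) * Lc))))))))
        + faceWtSum (ctrOff (d + 1) Lc) Lc * (((Lc : ℝ) ^ (d + 1)) * (Real.exp (δ * (((d : ℝ) + 1) * Lc))
            * (CL₂' * (1 + faceWtSum (ctrOff (d + 1) Lc) Lc * (((d + 1 : ℕ) : ℝ) * (2 * (Lc : ℝ) ^ (d + 1))) * Real.exp (δ * (3 * (((d + 1 : ℕ) : ℝ) * Lc))))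
                  * (1 + faceWtSum (ctrOff (d + 1) Lc) Lc * (((d + 1 : ℕ) : ℝ) * (2 * (Lc : ℝ) ^ (d + 1))) * Real.exp (δ * (((d + 1 : ℕ) : ℝ) * Lc)))))))
      + (faceWtSum (ctrOff (d + 1) Lc) Lc * (((Lc : ℝ) ^ (d + 1)) * (Real.exp (3 * δ * (((d : ℝ) + 1) * Lc))
            * (C₁' + faceWtSum (ctrOff (d + 1) Lc) Lc * (((d : ℝ) + 1) * ((2 * (Lc : ℝ) ^ (d + 1)) * (Real.exp (δ * (((d : ℝ) + 1) * Lc)) * C₁'))))))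
          + faceWtSum (ctrOff (d + 1) Lc) Lc * (((Lc : ℝ) ^ (d + 1)) * (Real.exp (δ * (((d : ℝ) + 1) * Lc)) * C₂')))) with hKP
  set CDp : ℝ := 2 * ((d : ℝ) + 1) * Lc * ((((2 * Lc + 1) ^ (d + 1) : ℕ) : ℝ) * (Real.exp (δ * (((d : ℝ) + 1) * Lc)) * C₂'))
        + 2 * ((d : ℝ) + 1) * Lc * ((((2 * Lc + 1) ^ (d + 1) : ℕ) : ℝ) * (Real.exp (3 * δ * (((d : ℝ) + 1) * Lc)) * (cKb d Lc δ * C₁')))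
        + 2 * ((d : ℝ) + 1) * Lc * ((((2 * Lc + 1) ^ (d + 1) : ℕ) : ℝ)
            * (Real.exp (δ * (((d : ℝ) + 1) * Lc)) * (cWb d Lc * Real.exp (3 * δ * (((d : ℝ) + 1) * Lc)) * (cKb d Lc δ * CL₁'))))
        + 2 * ((d : ℝ) + 1) * Lc * ((((2 * Lc + 1) ^ (d + 1) : ℕ) : ℝ)
            * (Real.exp (δ * (((d : ℝ) + 1) * Lc)) * (cKb d Lc δ * (cWb d Lc * Real.exp (3 * δ * (((d : ℝ) + 1) * Lc)) * (cKb d Lc δ * CL₂'))))) with hCDp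
  -- the four-variable Ψ-defects `D_l := 𝒯₄ Z_l − Z_l` (rate `δ`, `l`-free constant) and those of the differences (constant `K′·θ^l`, §1 + §2)
  have hD := fun l => locStencil₂_psiTable_sub_self_of_divergence_rows hLc0 hr (Z l) hδ.le (h₁ l) (h₂ l) (hL₁ l) (hL₂ l)
  have hDr : ∀ l, LocStencil₂ ((fun κ u κ' u' => comp (trK (psiKS (ctrOff (d + 1) Lc) Lc)) (comp (slotPsiS (ctrOff (d + 1) Lc) Lc (slotPsiS (ctrOff (d + 1) Lc) Lc (Z (l + 1)) κ u) κ' u') (psiKS (ctrOff (d + 1) Lc) Lc)) - Z (l + 1) κ u κ' u') - (fun κ u κ' u' => comp (trK (psiKS (ctrOff (d + 1) Lc) Lc)) (comp (slotPsiS (ctrOff (d + 1) Lc) Lc (slotPsiS (ctrOff (d + 1) Lc) Lc (Z l) κ u) κ' u') (psiKS (ctrOff (d + 1) Lc) Lc)) - Z l κ u κ' u')) (KP * θ ^ l) δ := fun l => by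
    have h := locStencil₂_psiTable_sub_self_of_divergence_rows hLc0 hr (Z (l + 1) - Z l) hδ.le (h₁' l) (h₂' l) (hL₁' l) (hL₂' l)
    rw [psiTableConst_mul, psiDefect_sub hLc0 hr] at h
    rw [hKP]
    exact h
  -- the comb defect tables `W_l := 𝔇 D_l + (𝔇 Z_l − Z_l)`: uniformly shaped (leaf-06's `locStencil₂_tableDress` + MY g66 FILE 1, `l`-free constant `C_W`) …
  set CW : ℝ := cKb d Lc δ * cKb d Lc δ * (cWb d Lc * Real.exp (3 * δ * (((d : ℝ) + 1) * Lc)) * (cKb d Lc δ * ((faceWtSum (ctrOff (d + 1) Lc) Lc * (((Lc : ℝ) ^ (d + 1)) * (Real.exp (δ * (((d : ℝ) + 1) * Lc))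
            * ((CL₁ * (1 + faceWtSum (ctrOff (d + 1) Lc) Lc * (((d + 1 : ℕ) : ℝ) * (2 * (Lc : ℝ) ^ (d + 1))) * Real.exp (δ * (3 * (((d + 1 : ℕ) : ℝ) * Lc))))
                  * (1 + faceWtSum (ctrOff (d + 1) Lc) Lc * (((d + 1 : ℕ) : ℝ) * (2 * (Lc : ℝ) ^ (d + 1))) * Real.exp (δ * (((d + 1 : ℕ) : ℝ) * Lc))))
              * (1 + faceWtSum (ctrOff (d + 1) Lc) Lc * (((d : ℝ) + 1) * ((2 * (Lc : ℝ) ^ (d + 1)) * Real.exp (δ * (((d : ℝ) + 1) * Lc))))))))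
        + faceWtSum (ctrOff (d + 1) Lc) Lc * (((Lc : ℝ) ^ (d + 1)) * (Real.exp (δ * (((d : ℝ) + 1) * Lc))
            * (CL₂ * (1 + faceWtSum (ctrOff (d + 1) Lc) Lc * (((d + 1 : ℕ) : ℝ) * (2 * (Lc : ℝ) ^ (d + 1))) * Real.exp (δ * (3 * (((d + 1 : ℕ) : ℝ) * Lc))))
                  * (1 + faceWtSum (ctrOff (d + 1) Lc) Lc * (((d + 1 : ℕ) : ℝ) * (2 * (Lc : ℝ) ^ (d + 1))) * Real.exp (δ * (((d + 1 : ℕ) : ℝ) * Lc)))))))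
      + (faceWtSum (ctrOff (d + 1) Lc) Lc * (((Lc : ℝ) ^ (d + 1)) * (Real.exp (3 * δ * (((d : ℝ) + 1) * Lc))
            * (C₁ + faceWtSum (ctrOff (d + 1) Lc) Lc * (((d : ℝ) + 1) * ((2 * (Lc : ℝ) ^ (d + 1)) * (Real.exp (δ * (((d : ℝ) + 1) * Lc)) * C₁))))))
          + faceWtSum (ctrOff (d + 1) Lc) Lc * (((Lc : ℝ) ^ (d + 1)) * (Real.exp (δ * (((d : ℝ) + 1) * Lc)) * C₂))))))
    + (2 * ((d : ℝ) + 1) * Lc * ((((2 * Lc + 1) ^ (d + 1) : ℕ) : ℝ) * (Real.exp (δ * (((d : ℝ) + 1) * Lc)) * C₂))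
        + 2 * ((d : ℝ) + 1) * Lc * ((((2 * Lc + 1) ^ (d + 1) : ℕ) : ℝ) * (Real.exp (3 * δ * (((d : ℝ) + 1) * Lc)) * (cKb d Lc δ * C₁)))
        + 2 * ((d : ℝ) + 1) * Lc * ((((2 * Lc + 1) ^ (d + 1) : ℕ) : ℝ)
            * (Real.exp (δ * (((d : ℝ) + 1) * Lc)) * (cWb d Lc * Real.exp (3 * δ * (((d : ℝ) + 1) * Lc)) * (cKb d Lc δ * CL₁))))
        + 2 * ((d : ℝ) + 1) * Lc * ((((2 * Lc + 1) ^ (d + 1) : ℕ) : ℝ)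
            * (Real.exp (δ * (((d : ℝ) + 1) * Lc)) * (cKb d Lc δ * (cWb d Lc * Real.exp (3 * δ * (((d : ℝ) + 1) * Lc)) * (cKb d Lc δ * CL₂)))))) with hCW
  have hW : ∀ l, LocStencil₂ ((fun κ u κ' u' => dressKBmAt (ctr (d + 1) Lc) Lc (coProjBmAtK (ctr (d + 1) Lc) Lc (fun κ₁ u₁ => coProjBmAtK (ctr (d + 1) Lc) Lc ((fun κ u κ' u' => comp (trK (psiKS (ctrOff (d + 1) Lc) Lc)) (comp (slotPsiS (ctrOff (d + 1) Lc) Lc (slotPsiS (ctrOff (d + 1) Lc) Lc (Z l) κ u) κ' u') (psiKS (ctrOff (d + 1) Lc) Lc)) - Z l κ u κ' u') κ₁ u₁) κ' u') κ u)) + ((fun κ u κ' u' => dressKBmAt (ctr (d + 1) Lc) Lc (coProjBmAtK (ctr (d + 1) Lc) Lc (fun κ₁ u₁ => coProjBmAtK (ctr (d + 1) Lc) Lc (Z l κ₁ u₁) κ' u') κ u)) - Z l)) CW δ := fun l => by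
    rw [hCW]
    exact locStencil₂_add' (locStencil₂_tableDress hLc1 hr (hD l) hδ.le)
      (locStencil₂_tableDress_sub_self_of_divergences hLc1 hr (Z l) hδ.le (h₂ l) (h₁ l) (hL₁ l) (hL₂ l))
  -- … with rate-shaped differences: `W_{l+1} − W_l = 𝔇 (D_{l+1} − D_l) + ((𝔇 Z_{l+1} − Z_{l+1}) − (𝔇 Z_l − Z_l))` (`tableDress_sub`; g66 §1 + `defectConst_mul`)
  have hWD : ∀ l, LocStencil₂ ((fun κ u κ' u' => dressKBmAt (ctr (d + 1) Lc) Lc (coProjBmAtK (ctr (d + 1) Lc) Lc (fun κ₁ u₁ => coProjBmAtK (ctr (d + 1) Lc) Lc ((fun κ u κ' u' => comp (trK (psiKS (ctrOff (d + 1) Lc) Lc)) (comp (slotPsiS (ctrOff (d + 1) Lc) Lc (slotPsiS (ctrOff (d + 1) Lc) Lc (Z (l + 1)) κ u) κ' u') (psiKS (ctrOff (d + 1) Lc) Lc)) - Z (l + 1) κ u κ' u') κ₁ u₁) κ' u') κ u)) - (fun κ u κ' u' => dressKBmAt (ctr (d + 1) Lc) Lc (coProjBmAtK (ctr (d + 1)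 Lc) Lc (fun κ₁ u₁ => coProjBmAtK (ctr (d + 1) Lc) Lc ((fun κ u κ' u' => comp (trK (psiKS (ctrOff (d + 1) Lc) Lc)) (comp (slotPsiS (ctrOff (d + 1) Lc) Lc (slotPsiS (ctrOff (d + 1) Lc) Lc (Z l) κ u) κ' u') (psiKS (ctrOff (d + 1) Lc) Lc)) - Z l κ u κ' u') κ₁ u₁) κ' u') κ u))) (κD * KP * θ ^ l) δ := fun l => by
    have h := locStencil₂_tableDress hLc1 hr (hDr l) hδ.le
    rw [tableDress_sub] at h
    refine locStencil₂_le_mono h (le_of_eq ?_) le_rfl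
    rw [hκD]; ring
  have hWE : ∀ l, LocStencil₂ (((fun κ u κ' u' => dressKBmAt (ctr (d + 1) Lc) Lc (coProjBmAtK (ctr (d + 1) Lc) Lc (fun κ₁ u₁ => coProjBmAtK (ctr (d + 1) Lc) Lc (Z (l + 1) κ₁ u₁) κ' u') κ u)) - Z (l + 1)) - ((fun κ u κ' u' => dressKBmAt (ctr (d + 1) Lc) Lc (coProjBmAtK (ctr (d + 1) Lc) Lc (fun κ₁ u₁ => coProjBmAtK (ctr (d + 1) Lc) Lc (Z l κ₁ u₁) κ' u') κ u)) - Z l)) (CDp * θ ^ l) δ := fun l => by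
    have h := locStencil₂_tableDress_defect_sub_of_divergences hLc1 hr (Z (l + 1)) (Z l) hδ.le (h₂' l) (h₁' l) (hL₁' l) (hL₂' l)
    rw [defectConst_mul] at h
    rw [hCDp]
    exact h
  have hWr : ∀ l, LocStencil₂ (((fun κ u κ' u' => dressKBmAt (ctr (d + 1) Lc) Lc (coProjBmAtK (ctr (d + 1) Lc) Lc (fun κ₁ u₁ => coProjBmAtK (ctr (d + 1) Lc) Lc ((fun κ u κ' u' => comp (trK (psiKS (ctrOff (d + 1) Lc) Lc)) (comp (slotPsiS (ctrOff (d + 1) Lc) Lc (slotPsiS (ctrOff (d + 1) Lc) Lc (Z (l + 1)) κ u) κ' u') (psiKS (ctrOff (d + 1) Lc) Lc)) - Z (l + 1) κ u κ' u') κ₁ u₁) κ' u') κ u)) + ((fun κ u κ' u' => dressKBmAt (ctr (d + 1) Lc) Lc (coProjBmAtK (ctr (d + 1) Lc) Lc (fun κ₁ u₁ => coProjBmAtK (ctr (d + 1) Lc) Lc (Z (l + 1) κ₁ u₁) κ' u') κ u)) - Z (l + 1))) - ((fun κ u κ' u' => dressKBmAt (ctr (d + 1) Lc) Lc (coProjBmAtK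 (ctr (d + 1) Lc) Lc (fun κ₁ u₁ => coProjBmAtK (ctr (d + 1) Lc) Lc ((fun κ u κ' u' => comp (trK (psiKS (ctrOff (d + 1) Lc) Lc)) (comp (slotPsiS (ctrOff (d + 1) Lc) Lc (slotPsiS (ctrOff (d + 1) Lc) Lc (Z l) κ u) κ' u') (psiKS (ctrOff (d + 1) Lc) Lc)) - Z l κ u κ' u') κ₁ u₁) κ' u') κ u)) + ((fun κ u κ' u' => dressKBmAt (ctr (d + 1) Lc) Lc (coProjBmAtK (ctr (d + 1) Lc) Lc (fun κ₁ u₁ => coProjBmAtK (ctr (d + 1) Lc) Lc (Z l κ₁ u₁) κ' u') κ u)) - Z l))) ((κD * KP + CDp) * θ ^ l) δ := fun l => by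
    have h := locStencil₂_add' (hWD l) (hWE l)
    have e : ((fun κ u κ' u' => dressKBmAt (ctr (d + 1) Lc) Lc (coProjBmAtK (ctr (d + 1) Lc) Lc (fun κ₁ u₁ => coProjBmAtK (ctr (d + 1) Lc) Lc ((fun κ u κ' u' => comp (trK (psiKS (ctrOff (d + 1) Lc) Lc)) (comp (slotPsiS (ctrOff (d + 1) Lc) Lc (slotPsiS (ctrOff (d + 1) Lc) Lc (Z (l + 1)) κ u) κ' u') (psiKS (ctrOff (d + 1) Lc) Lc)) - Z (l + 1) κ u κ' u') κ₁ u₁) κ' u') κ u)) + ((fun κ u κ' u' => dressKBmAt (ctr (d + 1) Lc) Lc (coProjBmAtK (ctr (d + 1) Lc) Lc (fun κ₁ u₁ => coProjBmAtK (ctr (d + 1) Lc) Lc (Z (l + 1) κ₁ u₁) κ' u') κ u)) - Z (l + 1))) - ((fun κ u κ' u' => dressKBmAt (ctr (d + 1) Lc) Lc (coProjBmAtK (ctr (d + 1) Lc) Lc (fun κ₁ u₁ => coProjBmAtK (ctr (d + 1) Lc) Lc ((fun κ u κ' u' => comp (trK (psiKS (ctrOff (d + 1) Lc) Lc)) (comp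 (slotPsiS (ctrOff (d + 1) Lc) Lc (slotPsiS (ctrOff (d + 1) Lc) Lc (Z l) κ u) κ' u') (psiKS (ctrOff (d + 1) Lc) Lc)) - Z l κ u κ' u') κ₁ u₁) κ' u') κ u)) + ((fun κ u κ' u' => dressKBmAt (ctr (d + 1) Lc) Lc (coProjBmAtK (ctr (d + 1) Lc) Lc (fun κ₁ u₁ => coProjBmAtK (ctr (d + 1) Lc) Lc (Z l κ₁ u₁) κ' u') κ u)) - Z l))
        = ((fun κ u κ' u' => dressKBmAt (ctr (d + 1) Lc) Lc (coProjBmAtK (ctr (d + 1) Lc) Lc (fun κ₁ u₁ => coProjBmAtK (ctr (d + 1) Lc) Lc ((fun κ u κ' u' => comp (trK (psiKS (ctrOff (d + 1) Lc) Lc)) (comp (slotPsiS (ctrOff (d + 1) Lc) Lc (slotPsiS (ctrOff (d + 1) Lc) Lc (Z (l + 1)) κ u) κ' u') (psiKS (ctrOff (d + 1) Lc) Lc)) - Z (l + 1) κ u κ' u') κ₁ u₁) κ' u') κ u)) - (fun κ u κ' u' => dressKBmAt (ctr (d + 1) Lc) Lc (coProjBmAtK (ctr (d + 1) Lc) Lc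 (fun κ₁ u₁ => coProjBmAtK (ctr (d + 1) Lc) Lc ((fun κ u κ' u' => comp (trK (psiKS (ctrOff (d + 1) Lc) Lc)) (comp (slotPsiS (ctrOff (d + 1) Lc) Lc (slotPsiS (ctrOff (d + 1) Lc) Lc (Z l) κ u) κ' u') (psiKS (ctrOff (d + 1) Lc) Lc)) - Z l κ u κ' u') κ₁ u₁) κ' u') κ u))) + (((fun κ u κ' u' => dressKBmAt (ctr (d + 1) Lc) Lc (coProjBmAtK (ctr (d + 1) Lc) Lc (fun κ₁ u₁ => coProjBmAtK (ctr (d + 1) Lc) Lc (Z (l + 1) κ₁ u₁) κ' u') κ u)) - Z (l + 1)) - ((fun κ u κ' u' => dressKBmAt (ctr (d + 1) Lc) Lc (coProjBmAtK (ctr (d + 1) Lc) Lc (fun κ₁ u₁ => coProjBmAtK (ctr (d + 1) Lc) Lc (Z l κ₁ u₁) κ' u') κ u)) - Z l)) := by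
      abel
    rw [e]
    exact locStencil₂_le_mono h (le_of_eq (by ring)) le_rfl
  -- the cell identity, level by level ((C-6) §2), and the split of the difference (leaf-01's `lin4_sub`)
  have hcell : ∀ l, lin4 c (unitK (sfStep Lc l) (smStep d Lc l) (GcombSh (d := d) Lc l)) Lc (Z l)
        - lin4 c (unitK (sfStep Lc l) (smStep d Lc l) (KInvStep (d := d) Lc l)) Lc (Z l)
      = lin4 c (unitK (sfStep Lc l) (smStep d Lc l) (KInvStep (d := d) Lc l)) Lc ((fun κ u κ' u' => dressKBmAt (ctr (d + 1) Lc) Lc (coProjBmAtK (ctr (d + 1) Lc) Lc (fun κ₁ u₁ => coProjBmAtK (ctr (d + 1) Lc) Lc ((fun κ u κ' u' => comp (trK (psiKS (ctrOff (d + 1) Lc) Lc)) (comp (slotPsiS (ctrOff (d + 1) Lc) Lc (slotPsiS (ctrOff (d + 1) Lc) Lc (Z l) κ u) κ' u') (psiKS (ctrOff (d + 1) Lc) Lc)) - Z l κ u κ' u') κ₁ u₁) κ' u') κ u)) + ((fun κ u κ' u' => dressKBmAt (ctr (d + 1) Lc) Lc (coProjBmAtK (ctr (d + 1) Lc) Lc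 (fun κ₁ u₁ => coProjBmAtK (ctr (d + 1) Lc) Lc (Z l κ₁ u₁) κ' u') κ u)) - Z l)) := by
    intro l
    obtain ⟨CZ, δZ, hδZ, hZl⟩ := hZ l
    exact comb_cell_eq_lin4_combDefect hLc c l hZl hδZ (hD l) hδ
  have e : ∀ l, (lin4 c (unitK (sfStep Lc (l + 1)) (smStep d Lc (l + 1)) (GcombSh (d := d) Lc (l + 1))) Lc (Z (l + 1))
          - lin4 c (unitK (sfStep Lc (l + 1)) (smStep d Lc (l + 1)) (KInvStep (d := d) Lc (l + 1))) Lc (Z (l + 1)))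
        - (lin4 c (unitK (sfStep Lc l) (smStep d Lc l) (GcombSh (d := d) Lc l)) Lc (Z l)
          - lin4 c (unitK (sfStep Lc l) (smStep d Lc l) (KInvStep (d := d) Lc l)) Lc (Z l))
      = (lin4 c (unitK (sfStep Lc (l + 1)) (smStep d Lc (l + 1)) (KInvStep (d := d) Lc (l + 1))) Lc ((fun κ u κ' u' => dressKBmAt (ctr (d + 1) Lc) Lc (coProjBmAtK (ctr (d + 1) Lc) Lc (fun κ₁ u₁ => coProjBmAtK (ctr (d + 1) Lc) Lc ((fun κ u κ' u' => comp (trK (psiKS (ctrOff (d + 1) Lc) Lc)) (comp (slotPsiS (ctrOff (d + 1) Lc) Lc (slotPsiS (ctrOff (d + 1) Lc) Lc (Z (l + 1)) κ u) κ' u') (psiKS (ctrOff (d + 1) Lc) Lc)) - Z (l + 1) κ u κ' u') κ₁ u₁) κ' u') κ u)) + ((fun κ u κ' u' => dressKBmAt (ctr (d + 1) Lc) Lc (coProjBmAtK (ctr (d + 1) Lc) Lc (fun κ₁ u₁ => coProjBmAtK (ctr (d + 1) Lc) Lc (Z (l + 1) κ₁ u₁) κ' u') κ u)) - Z (l + 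1)))
          - lin4 c (unitK (sfStep Lc l) (smStep d Lc l) (KInvStep (d := d) Lc l)) Lc ((fun κ u κ' u' => dressKBmAt (ctr (d + 1) Lc) Lc (coProjBmAtK (ctr (d + 1) Lc) Lc (fun κ₁ u₁ => coProjBmAtK (ctr (d + 1) Lc) Lc ((fun κ u κ' u' => comp (trK (psiKS (ctrOff (d + 1) Lc) Lc)) (comp (slotPsiS (ctrOff (d + 1) Lc) Lc (slotPsiS (ctrOff (d + 1) Lc) Lc (Z (l + 1)) κ u) κ' u') (psiKS (ctrOff (d + 1) Lc) Lc)) - Z (l + 1) κ u κ' u') κ₁ u₁) κ' u') κ u)) + ((fun κ u κ' u' => dressKBmAt (ctr (d + 1) Lc) Lc (coProjBmAtK (ctr (d + 1) Lc) Lc (fun κ₁ u₁ => coProjBmAtK (ctr (d + 1) Lc) Lc (Z (l + 1) κ₁ u₁) κ' u') κ u)) - Z (l + 1))))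
        + lin4 c (unitK (sfStep Lc l) (smStep d Lc l) (KInvStep (d := d) Lc l)) Lc (((fun κ u κ' u' => dressKBmAt (ctr (d + 1) Lc) Lc (coProjBmAtK (ctr (d + 1) Lc) Lc (fun κ₁ u₁ => coProjBmAtK (ctr (d + 1) Lc) Lc ((fun κ u κ' u' => comp (trK (psiKS (ctrOff (d + 1) Lc) Lc)) (comp (slotPsiS (ctrOff (d + 1) Lc) Lc (slotPsiS (ctrOff (d + 1) Lc) Lc (Z (l + 1)) κ u) κ' u') (psiKS (ctrOff (d + 1) Lc) Lc)) - Z (l + 1) κ u κ' u') κ₁ u₁) κ' u') κ u)) + ((fun κ u κ' u' => dressKBmAt (ctr (d + 1) Lc) Lc (coProjBmAtK (ctr (d + 1) Lc) Lc (fun κ₁ u₁ => coProjBmAtK (ctr (d + 1) Lc) Lc (Z (l + 1) κ₁ u₁) κ' u') κ u)) - Z (l + 1))) - ((fun κ u κ' u' => dressKBmAt (ctr (d + 1) Lc) Lc (coProjBmAtK (ctr (d + 1) Lc) Lc (fun κ₁ u₁ => coProjBmAtK (ctr (d + 1) Lc) Lc ((fun κ u κ' u' => comp (trK (psiKS (ctrOff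 (d + 1) Lc) Lc)) (comp (slotPsiS (ctrOff (d + 1) Lc) Lc (slotPsiS (ctrOff (d + 1) Lc) Lc (Z l) κ u) κ' u') (psiKS (ctrOff (d + 1) Lc) Lc)) - Z l κ u κ' u') κ₁ u₁) κ' u') κ u)) + ((fun κ u κ' u' => dressKBmAt (ctr (d + 1) Lc) Lc (coProjBmAtK (ctr (d + 1) Lc) Lc (fun κ₁ u₁ => coProjBmAtK (ctr (d + 1) Lc) Lc (Z l κ₁ u₁) κ' u') κ u)) - Z l))) := by
    intro l
    rw [hcell (l + 1), hcell l, lin4_sub (hK l) hδK c Lc (fun κ u κ' u' x z a b => sup_of_locStencil₂ hδ.le (hW (l + 1)) κ u κ' u' x z a b)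
      (fun κ u κ' u' x z a b => sup_of_locStencil₂ hδ.le (hW l) κ u κ' u' x z a b)]
    abel
  -- term 1: the transport DIFFERENCE on the next comb defect table (MY `lin_cauchy`)
  obtain ⟨m₀, hm₀_def⟩ : ∃ m₀ : ℝ, m₀ = min δK δ := ⟨_, rfl⟩
  have hm₀ : 0 < m₀ := by rw [hm₀_def]; exact lt_min hδK hδ
  have hK1 : ∀ j, Decays (unitK (sfStep Lc j) (smStep d Lc j) (KInvStep (d := d) Lc j)) CK m₀ :=
    fun j => decays_mono (hK j) hCK le_rfl (by rw [hm₀_def]; exact min_le_left _ _)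
  have hKc1 : ∀ k j, Decays ((unitK (sfStep Lc (k + j)) (smStep d Lc (k + j)) (KInvStep (d := d) Lc (k + j)))
      - (unitK (sfStep Lc k) (smStep d Lc k) (KInvStep (d := d) Lc k))) (cK * θK ^ k) m₀ :=
    fun k j => decays_mono (hKc k j) (by have h := (hKc k j).nonneg (Sum.inl 0); exact h) le_rfl (by rw [hm₀_def]; exact min_le_left _ _)
  have hW₀ : ∀ l, LocStencil₂ ((fun κ u κ' u' => dressKBmAt (ctr (d + 1) Lc) Lc (coProjBmAtK (ctr (d + 1) Lc) Lc (fun κ₁ u₁ => coProjBmAtK (ctr (d + 1) Lc) Lc ((fun κ u κ' u' => comp (trK (psiKS (ctrOff (d + 1) Lc) Lc)) (comp (slotPsiS (ctrOff (d + 1) Lc) Lc (slotPsiS (ctrOff (d + 1) Lc) Lc (Z l) κ u) κ' u') (psiKS (ctrOff (d + 1) Lc) Lc)) - Z l κ u κ' u') κ₁ u₁) κ' u') κ u)) + ((fun κ u κ' u' => dressKBmAt (ctr (d + 1) Lc) Lc (coProjBmAtK (ctr (d + 1) Lc) Lc (fun κ₁ u₁ => coProjBmAtK (ctr (d + 1)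 Lc) Lc (Z l κ₁ u₁) κ' u') κ u)) - Z l)) CW m₀ := fun l => (hW l).mono (by rw [hm₀_def]; exact min_le_right _ _)
  obtain ⟨L₁, hL₁_def⟩ : ∃ L₁ : ℝ, L₁ = |c| * lSand d CK (cBi d CK CW m₀) cK (lBi d CK CW cK 0 m₀) (m₀ / 32) := ⟨_, rfl⟩
  have h1 : ∀ l : ℕ, LocStencil₂ (lin4 c (unitK (sfStep Lc (l + 1)) (smStep d Lc (l + 1)) (KInvStep (d := d) Lc (l + 1))) Lc ((fun κ u κ' u' => dressKBmAt (ctr (d + 1) Lc) Lc (coProjBmAtK (ctr (d + 1) Lc) Lc (fun κ₁ u₁ => coProjBmAtK (ctr (d + 1) Lc) Lc ((fun κ u κ' u' => comp (trK (psiKS (ctrOff (d + 1) Lc) Lc)) (comp (slotPsiS (ctrOff (d + 1) Lc) Lc (slotPsiS (ctrOff (d + 1) Lc) Lc (Z (l + 1)) κ u) κ' u') (psiKS (ctrOff (d + 1) Lc) Lc)) - Z (l + 1) κ u κ' u') κ₁ u₁) κ' u') κ u)) + ((fun κ u κ' u' => dressKBmAt (ctr (d + 1) Lc) Lc (coProjBmAtK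 (ctr (d + 1) Lc) Lc (fun κ₁ u₁ => coProjBmAtK (ctr (d + 1) Lc) Lc (Z (l + 1) κ₁ u₁) κ' u') κ u)) - Z (l + 1)))
          - lin4 c (unitK (sfStep Lc l) (smStep d Lc l) (KInvStep (d := d) Lc l)) Lc ((fun κ u κ' u' => dressKBmAt (ctr (d + 1) Lc) Lc (coProjBmAtK (ctr (d + 1) Lc) Lc (fun κ₁ u₁ => coProjBmAtK (ctr (d + 1) Lc) Lc ((fun κ u κ' u' => comp (trK (psiKS (ctrOff (d + 1) Lc) Lc)) (comp (slotPsiS (ctrOff (d + 1) Lc) Lc (slotPsiS (ctrOff (d + 1) Lc) Lc (Z (l + 1)) κ u) κ' u') (psiKS (ctrOff (d + 1) Lc) Lc)) - Z (l + 1) κ u κ' u') κ₁ u₁) κ' u') κ u)) + ((fun κ u κ' u' => dressKBmAt (ctr (d + 1) Lc) Lc (coProjBmAtK (ctr (d + 1) Lc) Lc (fun κ₁ u₁ => coProjBmAtK (ctr (d + 1) Lc) Lc (Z (l + 1) κ₁ u₁) κ' u') κ u)) - Z (l + 1))))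
      (L₁ * θK ^ l) (m₀ / 128) := fun l => by
    rw [hL₁_def]
    exact lin_cauchy (Lc := Lc) (K := fun j => (unitK (sfStep Lc j) (smStep d Lc j) (KInvStep (d := d) Lc j))) hLc1 hm₀ hK1 hKc1 (hW₀ (l + 1)) c l 1
  have hL₁ : 0 ≤ L₁ := by have h := (h1 0).nonneg; simpa using h
  -- term 2: one undressed step of the comb defect's rate row (leaf-01's `exists_lin4_rate`)
  obtain ⟨L₂, hL₂, h2⟩ := exists_lin4_rate hLc1 c (fun l => ((fun κ u κ' u' => dressKBmAt (ctr (d + 1) Lc) Lc (coProjBmAtK (ctr (d + 1) Lc) Lc (fun κ₁ u₁ => coProjBmAtK (ctr (d + 1) Lc) Lc ((fun κ u κ' u' => comp (trK (psiKS (ctrOff (d + 1) Lc) Lc)) (comp (slotPsiS (ctrOff (d + 1) Lc) Lc (slotPsiS (ctrOff (d + 1) Lc) Lc (Z (l + 1)) κ u) κ' u') (psiKS (ctrOff (d + 1) Lc) Lc)) - Z (l + 1) κ u κ' u') κ₁ u₁) κ' u') κ u)) + ((fun κ u κ' u' => dressKBmAt (ctr (d + 1) Lc) Lc (coProjBmAtK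 (ctr (d + 1) Lc) Lc (fun κ₁ u₁ => coProjBmAtK (ctr (d + 1) Lc) Lc (Z (l + 1) κ₁ u₁) κ' u') κ u)) - Z (l + 1))) - ((fun κ u κ' u' => dressKBmAt (ctr (d + 1) Lc) Lc (coProjBmAtK (ctr (d + 1) Lc) Lc (fun κ₁ u₁ => coProjBmAtK (ctr (d + 1) Lc) Lc ((fun κ u κ' u' => comp (trK (psiKS (ctrOff (d + 1) Lc) Lc)) (comp (slotPsiS (ctrOff (d + 1) Lc) Lc (slotPsiS (ctrOff (d + 1) Lc) Lc (Z l) κ u) κ' u') (psiKS (ctrOff (d + 1) Lc) Lc)) - Z l κ u κ' u') κ₁ u₁) κ' u') κ u)) + ((fun κ u κ' u' => dressKBmAt (ctr (d + 1) Lc) Lc (coProjBmAtK (ctr (d + 1) Lc) Lc (fun κ₁ u₁ => coProjBmAtK (ctr (d + 1) Lc) Lc (Z l κ₁ u₁) κ' u') κ u)) - Z l))) hK hδK hWr hδ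
  refine ⟨L₁ + L₂, max θK θ, min (m₀ / 128) (min δK δ / 128), add_nonneg hL₁ hL₂, hθK0.trans (le_max_left _ _), max_lt hθK1 hθ1,
    lt_min (by positivity) (by positivity), fun l => ?_⟩
  rw [e l]
  exact locStencil₂_add_rate (h1 l) (h2 l) hL₁ hL₂ hθK0 hθ0

end Generic

end Summit.QuantumFields.BalabanUV.Beta.GAN24.CombHalfMemberCellDriftOfDivergences

end
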